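import Summits.BirchSwinnertonDyer.BirchSwinnertonDyer.Theorems.KolyvaginRoadThreeSchneiderTamAtThreeHeightLogNumeratorSeries
import Summits.BirchSwinnertonDyer.Uniform.UI.O2ScaleTranscendence
import HarnessLib

/-!
# Crux `SchneiderTamAtThree` (item 19154) — THE HEIGHT IS THE LOGARITHM OF THE NUMERATOR, part 2/4:
# the congruence of the uniformisation scale, `8(a₁² + a₂)·C² + 1 ≡ 0 (mod 3)`

HONEST FRAMING (cell `bsd-stepL`, seat `bsd-stepL-tam3-p2` g0, WIDTH-LEVER second lane «closed-form Schneider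
local factor at 3»; `--supports stmt-BirchSwinnertonDyer-19154 --as helper`): THEOREMS ONLY, unconditional,
route-independent (no Theses import); 0 definitions, 0 named facts, 0 sorry; nothing here proves the
crux `SchneiderTamAtThree`, Schneider's conjecture or BSD. Objects: ui-o2's `Σ²_E(P) = tateSigmaValueSq`
(`Uniform/UI/O2.lean`), SW's height (4.1) `heightFourOneCoord`, the tree's formal logarithm
`padicFormalLog`, `coshOfSq`, `tateSigmaSq`, `uniformisationScaleSq`.

* `norm_eight_mul_scaleSq_add_one_le` — for `W/ℚ` globally minimal with multiplicative reduction at `3`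
  and `‖q‖₃ < 1`: `‖8(a₁² + a₂)·C² + 1‖₃ ≤ 3⁻¹`, `C² = uniformisationScaleSq W 3 q =
  c₆(E_q)c₄(W)/(c₄(E_q)c₆(W))`. Mechanism: `c₄(E_q) = E₄(q) ≡ 1`, `c₆(E_q) = −E₆(q) ≡ −1`,
  `c₄(W) ≡ b₂²`, `c₆(W) ≡ −b₂³ (mod 3)` with `b₂ ≢ 0` (multiplicative reduction is `‖c₄‖₃ = 1`), so
  `C² ≡ 1/b₂ ≡ b₂` and `8(a₁²+a₂)C² + 1 ≡ −b₂² + 1 ≡ 0`. This is the congruence that makes the two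
  `z²/3`-terms of the transcription (from `⅓(a₁²+a₂)z³` in `log_W` and from `w²/24` in `ch`) CANCEL in
  `x·Σ²_E(P)` at `p = 3` — the only prime where they are not integral.

References: [SilvermanATAEC1994] Thm. V.3.1 (b); [SilvermanAEC2009] III.1; [SteinWuthrich2013] §4.2;
ui-o2 `Uniform/UI/O2SigmaValuation.lean`, `O2ScaleTranscendence.lean` (`‖c₄‖ = ‖c₆‖ = ‖C²‖ = 1`).
-/

noncomputable section

open scoped Classical Nat
open Filter Topology IsUltrametricDist PowerSeries
open WeierstrassCurve Literature.NumberTheory.EllipticCurves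
open Literature.NumberTheory.EllipticCurves.SteinWuthrich2013
open Literature.NumberTheory.EllipticCurves.TateCurve
open Literature.NumberTheory.EllipticCurves.Rank1Residual
open Summit.BirchSwinnertonDyer.Uniform.UI.O2

namespace Summit.BirchSwinnertonDyer.Rank1Residual.X11b.RegMult.HeightLogNumerator

/-! ### §5 The scale: `b₂·C² ≡ 1 (mod 3)` at a multiplicative `3` -/

section Scale

variable {W : WeierstrassCurve ℚ}

/-- `‖b₂‖, ‖b₄‖, ‖b₆‖ ≤ 1` in `ℚ₃` for a globally minimal `W/ℚ`. [folklore] -/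
private theorem norm_b_le_one [W.IsGloballyMinimal] :
    ‖(W.baseChange ℚ_[3]).b₂‖ ≤ 1 ∧ ‖(W.baseChange ℚ_[3]).b₄‖ ≤ 1 ∧ ‖(W.baseChange ℚ_[3]).b₆‖ ≤ 1 := by
  set V := W.baseChange ℚ_[3]
  have h := V.eq_map_integralModel
  refine ⟨?_, ?_, ?_⟩
  · have e := congrArg WeierstrassCurve.b₂ h
    rw [map_b₂] at e
    rw [← e]; exact PadicInt.norm_le_one _
  · have e := congrArg WeierstrassCurve.b₄ h
    rw [map_b₄] at e
    rw [← e]; exact PadicInt.norm_le_one _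
  · have e := congrArg WeierstrassCurve.b₆ h
    rw [map_b₆] at e
    rw [← e]; exact PadicInt.norm_le_one _

/-- **`‖8(a₁² + a₂)·C² + 1‖₃ ≤ 3⁻¹` at a multiplicative `3`.** For `W/ℚ` globally minimal with
multiplicative reduction at `3` and `‖q‖₃ < 1`: `C² = c₆(E_q)c₄(W)/(c₄(E_q)c₆(W))` with
`c₄(E_q) = E₄(q) ≡ 1`, `c₆(E_q) = −E₆(q) ≡ −1`, `c₄(W) = b₂² − 24b₄ ≡ b₂²`, `c₆(W) ≡ −b₂³ (mod 3)`
and `b₂ ≢ 0` (as `‖c₄(W)‖₃ = 1`), so `C² ≡ 1/b₂ ≡ b₂` and `8(a₁² + a₂)C² + 1 ≡ −b₂·b₂ + 1 ≡ 0 (mod 3)`.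
This is the congruence that makes the `z²/3`-terms of the formal logarithm and of `ch` CANCEL in
`x·Σ²_E(P)`. [cite: SteinWuthrich2013, §4.2 (p. 15)] [cite: SilvermanATAEC1994, Thm. V.3.1 (b)] -/
theorem norm_eight_mul_scaleSq_add_one_le [W.IsElliptic] [W.IsGloballyMinimal] (hW : Mult W 3)
    {q : ℚ_[3]} (hq : ‖q‖ < 1) :
    ‖8 * ((W.baseChange ℚ_[3]).a₁ ^ 2 + (W.baseChange ℚ_[3]).a₂) * uniformisationScaleSq W 3 q + 1‖
      ≤ 1 / 3 := by
  set V := W.baseChange ℚ_[3] with hVdef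
  obtain ⟨hb2, hb4, hb6⟩ := norm_b_le_one (W := W)
  obtain ⟨ha1, ha2, -, -, -⟩ := V.norm_coeffs_le_one
  have h12 : (12 : ℚ_[3]) ≠ 0 := by norm_num
  have hq1 : ‖q‖ ≤ 1 := hq.le
  have hq3 : ‖q‖ ≤ 1 / 3 := by
    have := norm_le_inv_of_norm_lt_one hq
    simpa using this
  -- the four invariants
  have hc4W : ‖V.c₄‖ = 1 := by
    have := norm_c₄_eq_one_of_hasMultiplicativeReductionAtPrime (W := W) (p := 3) hW
    rwa [show (W.c₄ : ℚ_[3]) = V.c₄ from ((map_c₄ W (algebraMap ℚ ℚ_[3])).trans (eq_ratCast _ _)).symm]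
      at this
  have hc6W : ‖V.c₆‖ = 1 := by
    have := norm_c₆_eq_one_of_mult (W := W) (p := 3) hW
    rwa [show (W.c₆ : ℚ_[3]) = V.c₆ from ((map_c₆ W (algebraMap ℚ ℚ_[3])).trans (eq_ratCast _ _)).symm]
      at this
  have hc4q : (tateCurve q).c₄ = 1 + 240 * tateS 3 q := by rw [tateCurve_c₄, tateE4_eq]
  have hc6q : (tateCurve q).c₆ = -(1 - 504 * tateS 5 q) := by rw [tateCurve_c₆ h12, tateE6]
  have hS3 : ‖tateS 3 q‖ ≤ 1 / 3 := (norm_tateS_le hq1).trans hq3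
  have hS5 : ‖tateS 5 q‖ ≤ 1 / 3 := (norm_tateS_le hq1).trans hq3
  have h240 : ‖(240 : ℚ_[3])‖ ≤ 1 / 3 := by
    rw [show (240 : ℚ_[3]) = ((80 : ℤ) : ℚ_[3]) * 3 by norm_num, norm_mul,
      show (3 : ℚ_[3]) = ((3 : ℕ) : ℚ_[3]) by norm_cast, Padic.norm_p]
    calc ‖((80 : ℤ) : ℚ_[3])‖ * (↑(3 : ℕ) : ℝ)⁻¹ ≤ 1 * (↑(3 : ℕ) : ℝ)⁻¹ := by
          gcongr; exact Padic.norm_int_le_one 80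
      _ = 1 / 3 := by norm_num
  have h504 : ‖(504 : ℚ_[3])‖ ≤ 1 / 3 := by
    rw [show (504 : ℚ_[3]) = ((168 : ℤ) : ℚ_[3]) * 3 by norm_num, norm_mul,
      show (3 : ℚ_[3]) = ((3 : ℕ) : ℚ_[3]) by norm_cast, Padic.norm_p]
    calc ‖((168 : ℤ) : ℚ_[3])‖ * (↑(3 : ℕ) : ℝ)⁻¹ ≤ 1 * (↑(3 : ℕ) : ℝ)⁻¹ := by
          gcongr; exact Padic.norm_int_le_one 168
      _ = 1 / 3 := by norm_num
  -- `A := c₆(E_q) + 1`, `B := c₄(E_q) − 1` are small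
  have hA : ‖(tateCurve q).c₆ + 1‖ ≤ 1 / 3 := by
    rw [hc6q, show -(1 - 504 * tateS 5 q) + 1 = 504 * tateS 5 q by ring, norm_mul]
    calc ‖(504 : ℚ_[3])‖ * ‖tateS 5 q‖ ≤ (1 / 3) * 1 := by
          gcongr; exact hS5.trans (by norm_num)
      _ = 1 / 3 := mul_one _
  have hB : ‖(tateCurve q).c₄ - 1‖ ≤ 1 / 3 := by
    rw [hc4q, show 1 + 240 * tateS 3 q - 1 = 240 * tateS 3 q by ring, norm_mul]
    calc ‖(240 : ℚ_[3])‖ * ‖tateS 3 q‖ ≤ (1 / 3) * 1 := by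
          gcongr; exact hS3.trans (by norm_num)
      _ = 1 / 3 := mul_one _
  have hc4q1 : ‖(tateCurve q).c₄‖ = 1 := norm_c₄_tateCurve_eq_one hq
  -- the denominator of `C²`
  have hden : ‖(tateCurve q).c₄ * V.c₆‖ = 1 := by rw [norm_mul, hc4q1, hc6W, one_mul]
  have hden0 : (tateCurve q).c₄ * V.c₆ ≠ 0 := norm_pos_iff.mp (by rw [hden]; exact one_pos)
  -- `c₄(W) = b₂² − 24 b₄`, `c₆(W) = −b₂³ + 36 b₂ b₄ − 216 b₆`, `a₁² + a₂ = b₂ − 3a₂`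
  have hc4b : V.c₄ = V.b₂ ^ 2 - 24 * V.b₄ := rfl
  have hc6b : V.c₆ = -V.b₂ ^ 3 + 36 * V.b₂ * V.b₄ - 216 * V.b₆ := rfl
  have hab : V.a₁ ^ 2 + V.a₂ = V.b₂ - 3 * V.a₂ := by rw [WeierstrassCurve.b₂]; ring
  -- write `8(a₁²+a₂)C² + 1 = N / (c₄(E_q) c₆(W))`
  have hCdef : uniformisationScaleSq W 3 q = (tateCurve q).c₆ * V.c₄ / ((tateCurve q).c₄ * V.c₆) := rfl
  have e : 8 * (V.a₁ ^ 2 + V.a₂) * uniformisationScaleSq W 3 q + 1 =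
      (8 * (V.b₂ - 3 * V.a₂) * ((tateCurve q).c₆ * V.c₄) + (tateCurve q).c₄ * V.c₆) /
        ((tateCurve q).c₄ * V.c₆) := by
    rw [hab, hCdef, eq_div_iff hden0, add_mul, one_mul, mul_assoc, div_mul_cancel₀ _ hden0]
  rw [e, norm_div, hden, div_one]
  -- split the numerator into small pieces:
  -- `N = 8 b₂ (A − 1) c₄ − 24 a₂ (c₆(E_q) c₄) + (B + 1) c₆` with `A = c₆(E_q)+1`, `B = c₄(E_q) − 1`
  -- `  = 8 b₂ A c₄ − 24 a₂ c₆(E_q) c₄ + B c₆ + (c₆ − 8 b₂ c₄)` and `c₆ − 8 b₂ c₄ = −9b₂³ + 228 b₂ b₄ − 216 b₆`.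
  have e2 : 8 * (V.b₂ - 3 * V.a₂) * ((tateCurve q).c₆ * V.c₄) + (tateCurve q).c₄ * V.c₆ =
      8 * V.b₂ * ((tateCurve q).c₆ + 1) * V.c₄ + (-(24 * V.a₂ * (tateCurve q).c₆ * V.c₄)) +
        (((tateCurve q).c₄ - 1) * V.c₆ + (-9 * V.b₂ ^ 3 + 228 * V.b₂ * V.b₄ - 216 * V.b₆)) := by
    rw [hc4b, hc6b]; ring
  rw [e2]
  have hc6q1 : ‖(tateCurve q).c₆‖ = 1 := norm_c₆_tateCurve_eq_one hq
  have h8 : ‖(8 : ℚ_[3])‖ ≤ 1 := by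
    have h : ((8 : ℤ) : ℚ_[3]) = 8 := by norm_cast
    rw [← h]; exact Padic.norm_int_le_one 8
  have h24 : ‖(24 : ℚ_[3])‖ ≤ 1 / 3 := by
    rw [show (24 : ℚ_[3]) = ((8 : ℤ) : ℚ_[3]) * 3 by norm_num, norm_mul,
      show (3 : ℚ_[3]) = ((3 : ℕ) : ℚ_[3]) by norm_cast, Padic.norm_p]
    calc ‖((8 : ℤ) : ℚ_[3])‖ * (↑(3 : ℕ) : ℝ)⁻¹ ≤ 1 * (↑(3 : ℕ) : ℝ)⁻¹ := by
          gcongr; exact Padic.norm_int_le_one 8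
      _ = 1 / 3 := by norm_num
  have h9 : ‖(9 : ℚ_[3])‖ ≤ 1 / 3 := by
    rw [show (9 : ℚ_[3]) = ((3 : ℤ) : ℚ_[3]) * 3 by norm_num, norm_mul,
      show (3 : ℚ_[3]) = ((3 : ℕ) : ℚ_[3]) by norm_cast, Padic.norm_p]
    calc ‖((3 : ℤ) : ℚ_[3])‖ * (↑(3 : ℕ) : ℝ)⁻¹ ≤ 1 * (↑(3 : ℕ) : ℝ)⁻¹ := by
          gcongr; exact Padic.norm_int_le_one 3
      _ = 1 / 3 := by norm_num
  have h228 : ‖(228 : ℚ_[3])‖ ≤ 1 / 3 := by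
    rw [show (228 : ℚ_[3]) = ((76 : ℤ) : ℚ_[3]) * 3 by norm_num, norm_mul,
      show (3 : ℚ_[3]) = ((3 : ℕ) : ℚ_[3]) by norm_cast, Padic.norm_p]
    calc ‖((76 : ℤ) : ℚ_[3])‖ * (↑(3 : ℕ) : ℝ)⁻¹ ≤ 1 * (↑(3 : ℕ) : ℝ)⁻¹ := by
          gcongr; exact Padic.norm_int_le_one 76
      _ = 1 / 3 := by norm_num
  have h216 : ‖(216 : ℚ_[3])‖ ≤ 1 / 3 := by
    rw [show (216 : ℚ_[3]) = ((72 : ℤ) : ℚ_[3]) * 3 by norm_num, norm_mul,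
      show (3 : ℚ_[3]) = ((3 : ℕ) : ℚ_[3]) by norm_cast, Padic.norm_p]
    calc ‖((72 : ℤ) : ℚ_[3])‖ * (↑(3 : ℕ) : ℝ)⁻¹ ≤ 1 * (↑(3 : ℕ) : ℝ)⁻¹ := by
          gcongr; exact Padic.norm_int_le_one 72
      _ = 1 / 3 := by norm_num
  refine (norm_add_le_max _ _).trans (max_le ((norm_add_le_max _ _).trans (max_le ?_ ?_))
    ((norm_add_le_max _ _).trans (max_le ?_ ?_)))
  · rw [norm_mul, norm_mul, norm_mul]
    calc ‖(8 : ℚ_[3])‖ * ‖V.b₂‖ * ‖(tateCurve q).c₆ + 1‖ * ‖V.c₄‖ ≤ 1 * 1 * (1 / 3) * 1 := by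
          gcongr; exact hc4W.le
      _ = 1 / 3 := by norm_num
  · rw [norm_neg, norm_mul, norm_mul, norm_mul]
    calc ‖(24 : ℚ_[3])‖ * ‖V.a₂‖ * ‖(tateCurve q).c₆‖ * ‖V.c₄‖ ≤ (1 / 3) * 1 * 1 * 1 := by
          gcongr
          · exact hc6q1.le
          · exact hc4W.le
      _ = 1 / 3 := by norm_num
  · rw [norm_mul]
    calc ‖(tateCurve q).c₄ - 1‖ * ‖V.c₆‖ ≤ (1 / 3) * 1 := by gcongr; exact hc6W.le
      _ = 1 / 3 := mul_one _
  · refine (norm_sub_le_max₃ _ _).trans (max_le ((norm_add_le_max _ _).trans (max_le ?_ ?_)) ?_)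
    · rw [norm_mul, norm_pow]
      calc ‖(-9 : ℚ_[3])‖ * ‖V.b₂‖ ^ 3 ≤ (1 / 3) * 1 ^ 3 := by
            gcongr
            · rw [norm_neg]; exact h9
        _ = 1 / 3 := by norm_num
    · rw [norm_mul, norm_mul]
      calc ‖(228 : ℚ_[3])‖ * ‖V.b₂‖ * ‖V.b₄‖ ≤ (1 / 3) * 1 * 1 := by gcongr
        _ = 1 / 3 := by norm_num
    · rw [norm_mul]
      calc ‖(216 : ℚ_[3])‖ * ‖V.b₆‖ ≤ (1 / 3) * 1 := by gcongr
        _ = 1 / 3 := mul_one _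

end Scale


end Summit.BirchSwinnertonDyer.Rank1Residual.X11b.RegMult.HeightLogNumerator

end
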